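import Literature.AlgebraicGeometry.AbelianSchemes.DualIsogenyMul
import Literature.AlgebraicGeometry.AbelianSchemes.DualIsogenyMulN
import Literature.AlgebraicGeometry.AbelianSchemes.AbelianSchemeDualIsogenyHom
import Literature.AlgebraicGeometry.AbelianSchemes.AbelianSchemeDualIsogenyComp
import Literature.AlgebraicGeometry.AbelianSchemes.AbelianSchemeQuotientPolarizationIdentity
import Literature.AlgebraicGeometry.AbelianSchemes.AbelianSchemeOverRingAction
import HarnessLib

/-!
# The DUAL ring action `ι^∨ : 𝒪 → End(Â)`, `a ↦ ι(a)^∨`, of a ring action `ι : 𝒪 → End(A)` ([MumfordAV1970] §15; [RSZ2020] §3.2)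

Topic `Literature/AlgebraicGeometry/AbelianSchemes`, namespace `Literature.AlgebraicGeometry.AbelianSchemes.AbelianSchemeOver` (one construction with body + proved
theorems; no named fact, no `sorry`, no `instance`, no notation; base `S` REDUCED and locally Noetherian, unit hypothesis `hD` — the standing hypotheses of
★ `dualIsogenyOver_mulN` ∕ ★ `isMonHom_dualIsogenyOver` ∕ ★ `dualIsogenyOver_mul`).  Cell `hodgecm-mathlib`, F0/P6 «MOD», organ **(D1)** of the Serre-tensor
family (the `𝒪`-structure on `Â` needed for a dual pair ∕ polarisation ON `A ⊗_𝒪 𝔟`: `(A ⊗_𝒪 𝔟)^∨ = Â ⊗_𝒪 𝔟^∨` with `Â` an `𝒪`-abelian scheme through `ι^∨`), over ★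
(D-add) `DualIsogenyMul` (`(v₁v₂)^∨ = v₁^∨ v₂^∨`), ★ `DualIsogenyMulN` (`[n]^∨ = [n]`), ★ `AbelianSchemeDualIsogenyComp` (`(ψχ)^∨ = χ^∨ψ^∨`), ★
`AbelianSchemeDualIsogenyHom` (`ψ^∨` is a homomorphism), ★ `dualIsogenyOver_congr`; `--supports stmt-HodgeConjecture-24832`, count-neutral.  HC_CM is proved only
modulo the 2 remaining named inputs (hLiu418, h413) until rung 0 closes; this file discharges none of them.

## Mathematics

`f ↦ f^∨ : End(A) → End(Â)` is a unital ANTI-homomorphism of rings (`(fg)^∨ = g^∨f^∨`, `(f+g)^∨ = f^∨+g^∨`, `[n]^∨ = [n]`); composed with a ring action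
`ι : 𝒪 → End(A)` of a COMMUTATIVE ring it is again a ring action `ι^∨(a) := ι(a)^∨` on `Â` ([MumfordAV1970] §15 Thm. 1; [RapoportSmithlingZhang2020Diagonal] §3.2:
the induced `𝒪_F`-action on `A^∨`, there composed with complex conjugation — the conjugation is a RING automorphism of `𝒪`, applied by the consumer).

## Contents

* `dualIsogenyOver_id'` (`(𝟙)^∨ = 𝟙`), `dualIsogenyOver_unit'` (`(1)^∨ = 1`) — from ★ `dualIsogenyOver_mulN` at `n = 1, 0`;
* **`RingAction.dual act D hD : D.hat.RingAction O`** with **`RingAction.dual_i : (act.dual D hD).i a = dualIsogenyOver (act.i a) D D`**.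

## References
* [MumfordAV1970] D. Mumford, *Abelian Varieties* (1970), §15 Thm. 1 (p. 143).
* [MilneAV2008] J. S. Milne, *Abelian Varieties* (2008), I §9 Thm. 9.1 (p. 42).
* [RapoportSmithlingZhang2020Diagonal] M. Rapoport, B. Smithling, W. Zhang (2020), §3.2 (the `𝒪_F`-action on the dual).
* Tree: ★ `DualIsogenyMul`, ★ `DualIsogenyMulN`, ★ `AbelianSchemeDualIsogenyComp`, ★ `AbelianSchemeDualIsogenyHom`, ★ `AbelianSchemeOverRingAction`.
-/

noncomputable section

universe u

open CategoryTheory CategoryTheory.Limits AlgebraicGeometry MonoidalCategory CartesianMonoidalCategory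
open scoped MonObj

namespace Literature.AlgebraicGeometry.AbelianSchemes

namespace AbelianSchemeOver

variable {S : Scheme.{u}} [IsReduced S] [IsLocallyNoetherian S] {A : AbelianSchemeOver S} (D : A.DualPair)
  (hD : Nonempty ((Scheme.Modules.pullback (DualPair.unitHatSlice D)).obj D.P ≅ SheafOfModules.unit _))

namespace DualPair

include hD in
/-- `(𝟙_A)^∨ = 𝟙_{Â}` (★ `[n]^∨ = [n]` at `n = 1`). [cite: MumfordAV1970, §15 Thm. 1 (p. 143)] -/
theorem dualIsogenyOver_id' : dualIsogenyOver (𝟙 A.X) D D = 𝟙 D.hat.X := by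
  haveI : IsCommMonObj A.X := A.isCommMonObj_of_isReduced_base
  exact (dualIsogenyOver_congr D D (ψ₁ := 𝟙 A.X) (ψ₂ := A.mulN 1) (by rw [mulN_def, pow_one])).trans
    ((D.dualIsogenyOver_mulN hD 1).trans (by rw [mulN_def, pow_one]))

include hD in
/-- `(1)^∨ = 1` for the unit homomorphism `1 = [0] : A → A` (★ `[n]^∨ = [n]` at `n = 0`). [cite: MumfordAV1970, §15 Thm. 1 (p. 143)] -/
theorem dualIsogenyOver_unit' [IsMonHom (1 : A.X ⟶ A.X)] : dualIsogenyOver (1 : A.X ⟶ A.X) D D = 1 := by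
  haveI : IsCommMonObj A.X := A.isCommMonObj_of_isReduced_base
  exact (dualIsogenyOver_congr D D (ψ₁ := (1 : A.X ⟶ A.X)) (ψ₂ := A.mulN 0) (by rw [mulN_def, pow_zero])).trans
    ((D.dualIsogenyOver_mulN hD 0).trans (by rw [mulN_def, pow_zero]))

end DualPair

namespace RingAction

variable {O : Type*} [CommRing O] (act : A.RingAction O)

/-- **The DUAL ring action `ι^∨` on `Â`**: `ι^∨(a) := ι(a)^∨ = dualIsogenyOver (ι a) D D`; it is a ring action because `f ↦ f^∨` is a unital additive
anti-homomorphism and `𝒪` is commutative. [cite: MumfordAV1970, §15 Thm. 1 (p. 143)] [cite: RapoportSmithlingZhang2020Diagonal, §3.2] -/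
def dual : D.hat.RingAction O where
  i a := haveI := act.isMonHom a; DualPair.dualIsogenyOver (act.i a) D D
  isMonHom a := by
    haveI := act.isMonHom a
    exact DualPair.isMonHom_dualIsogenyOver (act.i a) D D hD hD
  i_one := by
    haveI := act.isMonHom (1 : O)
    exact (DualPair.dualIsogenyOver_congr D D (ψ₁ := act.i 1) (ψ₂ := 𝟙 A.X) act.i_one).trans (DualPair.dualIsogenyOver_id' D hD)
  i_mul a b := by
    haveI := act.isMonHom a
    haveI := act.isMonHom b
    haveI := act.isMonHom (a * b)
    -- `ι(ab) = ι(a) ≫ ι(b)` (commutativity), whose dual is `ι(b)^∨ ≫ ι(a)^∨`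
    exact (DualPair.dualIsogenyOver_congr D D (ψ₁ := act.i (a * b)) (ψ₂ := act.i a ≫ act.i b)
      (by rw [act.i_mul, act.i_comm])).trans (DualPair.dualIsogenyOver_comp (act.i a) (act.i b) D D D)
  i_zero := by
    haveI := act.isMonHom (0 : O)
    haveI : IsMonHom (1 : A.X ⟶ A.X) := by rw [← act.i_zero]; exact act.isMonHom 0
    exact (DualPair.dualIsogenyOver_congr D D (ψ₁ := act.i 0) (ψ₂ := (1 : A.X ⟶ A.X)) act.i_zero).trans
      (DualPair.dualIsogenyOver_unit' D hD)
  i_add a b := by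
    haveI := act.isMonHom a
    haveI := act.isMonHom b
    haveI := act.isMonHom (a + b)
    haveI : IsMonHom (act.i a * act.i b) := by rw [← act.i_add]; exact act.isMonHom (a + b)
    exact (DualPair.dualIsogenyOver_congr D D (ψ₁ := act.i (a + b)) (ψ₂ := act.i a * act.i b) (act.i_add a b)).trans
      (DualPair.dualIsogenyOver_mul D D hD (act.i a) (act.i b))

/-- `ι^∨(a) = ι(a)^∨` (definitional). [cite: MumfordAV1970, §15 Thm. 1 (p. 143)] -/
theorem dual_i (a : O) :
    (act.dual D hD).i a = (haveI := act.isMonHom a; DualPair.dualIsogenyOver (act.i a) D D) := rfl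

end RingAction

end AbelianSchemeOver

end Literature.AlgebraicGeometry.AbelianSchemes

end
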